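import Mathlib
import HarnessLib
import Literature.NumberTheory.Transcendental.KZCalculus
import Literature.NumberTheory.Transcendental.KZSemiCanonicalReductionProofs
import Literature.NumberTheory.Transcendental.KZLogCalculusProofs
import Literature.NumberTheory.Transcendental.SemialgebraicMapsProofs
import Literature.NumberTheory.Transcendental.SemialgebraicVolume

/-!
# Cutting a Janus band representation by a rational base hyperplane (line `janus-bands`)

Rule (1a) of the Kontsevich–Zagier calculus for the literal class `JJ B k` of the skeleton
(crux `ArrangementNormalForm`): a Janus band representation `s` with base rows `M` is congruent
modulo `KZ.relations` to the sum of its two restrictions to the open half-spaces `{±h > 0}` of a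
non-zero rational affine form `h` on the base, which are Janus band representations with base
rows `Fin.snoc M h`, `Fin.snoc M (−h)` and the same integrand data (the hyperplane section is
Lebesgue-null).

Main result: `separatePos_cut` (registered sub-goal of `stub_separatePos`); iterated, it is the
fine rational dissection of the base cell used (i) to make every letter non-vanishing on each
piece and (ii) to localise the pieces to neighbourhoods carrying a good direction.
-/

noncomputable section

open Set MeasureTheory MvPolynomial

namespace Summit.KontsevichZagierPeriods.ArrangementNormalForm.JanusBands

open Literature.NumberTheory.Transcendental

namespace SeparatePos

variable {B k : ℕ}

/-- The linear polynomial of a base affine form does not vanish identically unless the form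
is zero. -/
theorem formPoly_ne_zero (h : (Fin B → ℚ) × ℚ) (hh : h ≠ 0) :
    (∑ i, MvPolynomial.C (h.1 i) * MvPolynomial.X (Fin.castAdd k i) + MvPolynomial.C h.2 :
      MvPolynomial (Fin (B + k)) ℚ) ≠ 0 := by
  intro hq
  apply hh
  have h2 : h.2 = 0 := by
    have := congr_arg (MvPolynomial.aeval (fun _ : Fin (B + k) => (0 : ℚ))) hq
    simpa [map_sum] using this
  have h1 : ∀ i, h.1 i = 0 := fun i => by
    have := congr_arg
      (MvPolynomial.aeval (fun l : Fin (B + k) => if l = Fin.castAdd k i then (1 : ℚ) else 0)) hq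
    simpa [map_sum, h2, Finset.sum_ite_eq'] using this
  exact Prod.ext (funext h1) h2

/-- A rational base hyperplane is Lebesgue-null. -/
theorem volume_form_eq_zero (h : (Fin B → ℚ) × ℚ) (hh : h ≠ 0) :
    volume {z : Fin (B + k) → ℝ | ∑ i, (h.1 i : ℝ) * z (Fin.castAdd k i) + (h.2 : ℝ) = 0} = 0 := by
  have hq := formPoly_ne_zero (k := k) h hh
  have hq' : MvPolynomial.map (algebraMap ℚ ℝ) (∑ i, MvPolynomial.C (h.1 i) *
      MvPolynomial.X (Fin.castAdd k i) + MvPolynomial.C h.2) ≠ 0 := fun h0 =>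
    hq (MvPolynomial.map_injective _ (algebraMap ℚ ℝ).injective (by rw [h0, map_zero]))
  convert volume_setOf_aeval_eq_zero _ hq' using 3 with z
  simp [map_sum]

/-- An open rational half-space of the base is `ℚ`-semialgebraic. -/
theorem isSemialgebraic_form_pos (h : (Fin B → ℚ) × ℚ) :
    Literature.ModelTheory.ExponentialFields.IsSemialgebraic ℚ
      {z : Fin (B + k) → ℝ | 0 < ∑ i, (h.1 i : ℝ) * z (Fin.castAdd k i) + (h.2 : ℝ)} := by
  convert Literature.ModelTheory.ExponentialFields.isSemialgebraic_setOf_eval_pos (R := ℝ)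
    (∑ i, MvPolynomial.C (h.1 i) * MvPolynomial.X (Fin.castAdd k i) + MvPolynomial.C h.2 :
      MvPolynomial (Fin (B + k)) ℚ) using 2 with z
  simp [MvPolynomial.aeval_def]

/-- Negating a base affine form negates its values. -/
theorem form_neg (h : (Fin B → ℚ) × ℚ) (z : Fin (B + k) → ℝ) :
    ∑ i, ((-h).1 i : ℝ) * z (Fin.castAdd k i) + ((-h).2 : ℝ) =
      -(∑ i, (h.1 i : ℝ) * z (Fin.castAdd k i) + (h.2 : ℝ)) := by
  simp only [Prod.fst_neg, Prod.snd_neg, Pi.neg_apply, Rat.cast_neg, neg_mul,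
    Finset.sum_neg_distrib]
  ring

end SeparatePos

open SeparatePos in
/-- **Cutting a Janus band by a rational base hyperplane** (rule 1a; registered sub-goal of
`stub_separatePos`). Let `s` be a Janus band representation with base `ℝ^B` and `k` fibres
(literal `JJ B k` data) and `h ≠ 0` a rational affine form on the base. Then
`[s] − [s₁] − [s₂] ∈ KZ.relations`, where `s₁`, `s₂` are the restrictions of `s` to the open
half-spaces `{h > 0}`, `{h < 0}`: Janus band representations with base rows `Fin.snoc M h`,
`Fin.snoc M (−h)` and the same integrand data (the section `{h = 0}` is Lebesgue-null,
`KZ.of_sub_sum_of_mem_relations`). -/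
theorem separatePos_cut (B k m m' : ℕ) (s : KZ.IntegralRep (B + k)) (M : Fin m' → (Fin B → ℚ) × ℚ) (L : Fin m → (Fin B → ℚ) × ℚ) (e : Fin m → ℕ) (p : MvPolynomial (Fin B) ℚ) (a : Fin k → Option ((Fin B → ℚ) × ℚ)) (lo hi : Fin k → Fin k ⊕ ((Fin B → ℚ) × ℚ)) (hbd : Bornology.IsBounded s.domain) (hdom : s.domain = {z | (∀ j, 0 < ∑ i, ((M j).1 i : ℝ) * z (Fin.castAdd k i) + ((M j).2 : ℝ)) ∧ ∀ i, Sum.elim (fun j => z (Fin.natAdd B j)) (fun c => ∑ i', (c.1 i' : ℝ) * z (Fin.castAdd k i') + (c.2 : ℝ)) (lo i) < z (Fin.natAdd B i) ∧ z (Fin.natAdd B i) < Sum.elim (fun j => z (Fin.natAdd B j)) (fun c => ∑ i', (c.1 i' : ℝ) * z (Fin.castAdd k i') + (c.2 : ℝ)) (hi i)}) (hint : EqOn s.integrand (fun z => MvPolynomial.aeval (fun i => z (Fin.castAdd k i)) p / (∏ j, (∑ i, ((L j).1 i : ℝ) * z (Fin.castAdd k i) + ((L j).2 : ℝ)) ^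 e j) * ∏ i, (a i).elim 1 (fun c => 1 / (z (Fin.natAdd B i) - (∑ i', (c.1 i' : ℝ) * z (Fin.castAdd k i') + (c.2 : ℝ))))) s.domain) (h : (Fin B → ℚ) × ℚ) (hh : h ≠ 0) : ∃ (M₁ M₂ : Fin (m' + 1) → (Fin B → ℚ) × ℚ) (s₁ s₂ : KZ.IntegralRep (B + k)), M₁ = Fin.snoc M h ∧ M₂ = Fin.snoc M (-h) ∧ (∀ z, z ∈ s₁.domain ↔ z ∈ s.domain ∧ 0 < ∑ i, (h.1 i : ℝ) * z (Fin.castAdd k i) + (h.2 : ℝ)) ∧ (∀ z, z ∈ s₂.domain ↔ z ∈ s.domain ∧ ∑ i, (h.1 i : ℝ) * z (Fin.castAdd k i) + (h.2 : ℝ) < 0) ∧ s₁.integrand = s.integrand ∧ s₂.integrand = s.integrand ∧ Bornology.IsBounded s₁.domain ∧ s₁.domain = {z | (∀ j, 0 < ∑ i, ((M₁ j).1 i : ℝ) * z (Fin.castAdd k i) + ((M₁ j).2 : ℝ)) ∧ ∀ i, Sum.elim (fun j => z (Fin.natAdd B j)) (fun c => ∑ i', (c.1 i' : ℝ) * z (Fin.castAdd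 k i') + (c.2 : ℝ)) (lo i) < z (Fin.natAdd B i) ∧ z (Fin.natAdd B i) < Sum.elim (fun j => z (Fin.natAdd B j)) (fun c => ∑ i', (c.1 i' : ℝ) * z (Fin.castAdd k i') + (c.2 : ℝ)) (hi i)} ∧ EqOn s₁.integrand (fun z => MvPolynomial.aeval (fun i => z (Fin.castAdd k i)) p / (∏ j, (∑ i, ((L j).1 i : ℝ) * z (Fin.castAdd k i) + ((L j).2 : ℝ)) ^ e j) * ∏ i, (a i).elim 1 (fun c => 1 / (z (Fin.natAdd B i) - (∑ i', (c.1 i' : ℝ) * z (Fin.castAdd k i') + (c.2 : ℝ))))) s₁.domain ∧ Bornology.IsBounded s₂.domain ∧ s₂.domain = {z | (∀ j, 0 < ∑ i, ((M₂ j).1 i : ℝ) * z (Fin.castAdd k i) + ((M₂ j).2 : ℝ)) ∧ ∀ i, Sum.elim (fun j => z (Fin.natAdd B j)) (fun c => ∑ i', (c.1 i' : ℝ) * z (Fin.castAdd k i') + (c.2 : ℝ)) (lo i) < z (Fin.natAdd B i) ∧ z (Fin.natAdd B i) < Sum.elim (fun j => z (Fin.natAdd B j)) (fun c => ∑ i',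 (c.1 i' : ℝ) * z (Fin.castAdd k i') + (c.2 : ℝ)) (hi i)} ∧ EqOn s₂.integrand (fun z => MvPolynomial.aeval (fun i => z (Fin.castAdd k i)) p / (∏ j, (∑ i, ((L j).1 i : ℝ) * z (Fin.castAdd k i) + ((L j).2 : ℝ)) ^ e j) * ∏ i, (a i).elim 1 (fun c => 1 / (z (Fin.natAdd B i) - (∑ i', (c.1 i' : ℝ) * z (Fin.castAdd k i') + (c.2 : ℝ))))) s₂.domain ∧ KZ.of s - KZ.of s₁ - KZ.of s₂ ∈ KZ.relations := by
  -- the two half-band domains, literally of `JJ` shape with the extra row `±h`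
  have key : ∀ (g : (Fin B → ℚ) × ℚ) (z : Fin (B + k) → ℝ), z ∈ {z : Fin (B + k) → ℝ |
      (∀ j, 0 < ∑ i, (((Fin.snoc M g : Fin (m' + 1) → (Fin B → ℚ) × ℚ) j).1 i : ℝ) *
        z (Fin.castAdd k i) + (((Fin.snoc M g : Fin (m' + 1) → (Fin B → ℚ) × ℚ) j).2 : ℝ)) ∧
      ∀ i, Sum.elim (fun j => z (Fin.natAdd B j))
        (fun c => ∑ i', (c.1 i' : ℝ) * z (Fin.castAdd k i') + (c.2 : ℝ)) (lo i) <
        z (Fin.natAdd B i) ∧ z (Fin.natAdd B i) < Sum.elim (fun j => z (Fin.natAdd B j))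
        (fun c => ∑ i', (c.1 i' : ℝ) * z (Fin.castAdd k i') + (c.2 : ℝ)) (hi i)} ↔
      z ∈ s.domain ∧ 0 < ∑ i, (g.1 i : ℝ) * z (Fin.castAdd k i) + (g.2 : ℝ) := fun g z => by
    rw [hdom]
    simp only [mem_setOf_eq, Fin.forall_fin_succ', Fin.snoc_castSucc, Fin.snoc_last]
    tauto
  set D₁ : Set (Fin (B + k) → ℝ) := {z : Fin (B + k) → ℝ |
      (∀ j, 0 < ∑ i, (((Fin.snoc M h : Fin (m' + 1) → (Fin B → ℚ) × ℚ) j).1 i : ℝ) *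
        z (Fin.castAdd k i) + (((Fin.snoc M h : Fin (m' + 1) → (Fin B → ℚ) × ℚ) j).2 : ℝ)) ∧
      ∀ i, Sum.elim (fun j => z (Fin.natAdd B j))
        (fun c => ∑ i', (c.1 i' : ℝ) * z (Fin.castAdd k i') + (c.2 : ℝ)) (lo i) <
        z (Fin.natAdd B i) ∧ z (Fin.natAdd B i) < Sum.elim (fun j => z (Fin.natAdd B j))
        (fun c => ∑ i', (c.1 i' : ℝ) * z (Fin.castAdd k i') + (c.2 : ℝ)) (hi i)} with hD₁
  set D₂ : Set (Fin (B + k) → ℝ) := {z : Fin (B + k) → ℝ |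
      (∀ j, 0 < ∑ i, (((Fin.snoc M (-h) : Fin (m' + 1) → (Fin B → ℚ) × ℚ) j).1 i : ℝ) *
        z (Fin.castAdd k i) + (((Fin.snoc M (-h) : Fin (m' + 1) → (Fin B → ℚ) × ℚ) j).2 : ℝ)) ∧
      ∀ i, Sum.elim (fun j => z (Fin.natAdd B j))
        (fun c => ∑ i', (c.1 i' : ℝ) * z (Fin.castAdd k i') + (c.2 : ℝ)) (lo i) <
        z (Fin.natAdd B i) ∧ z (Fin.natAdd B i) < Sum.elim (fun j => z (Fin.natAdd B j))
        (fun c => ∑ i', (c.1 i' : ℝ) * z (Fin.castAdd k i') + (c.2 : ℝ)) (hi i)} with hD₂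
  have hmem₁ : ∀ z, z ∈ D₁ ↔ z ∈ s.domain ∧
      0 < ∑ i, (h.1 i : ℝ) * z (Fin.castAdd k i) + (h.2 : ℝ) := key h
  have hmem₂ : ∀ z, z ∈ D₂ ↔ z ∈ s.domain ∧
      ∑ i, (h.1 i : ℝ) * z (Fin.castAdd k i) + (h.2 : ℝ) < 0 := fun z => by
    rw [key (-h) z, form_neg, neg_pos]
  have heq₁ : D₁ = s.domain ∩ {z | 0 < ∑ i, (h.1 i : ℝ) * z (Fin.castAdd k i) + (h.2 : ℝ)} :=
    Set.ext hmem₁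
  have heq₂ : D₂ = s.domain ∩
      {z | 0 < ∑ i, ((-h).1 i : ℝ) * z (Fin.castAdd k i) + ((-h).2 : ℝ)} :=
    Set.ext fun z => by rw [hmem₂, mem_inter_iff, mem_setOf_eq, form_neg, neg_pos]
  have hsa₁ : Literature.ModelTheory.ExponentialFields.IsSemialgebraic ℚ D₁ :=
    heq₁ ▸ s.isSemialgebraic_domain.inter (isSemialgebraic_form_pos h)
  have hsa₂ : Literature.ModelTheory.ExponentialFields.IsSemialgebraic ℚ D₂ :=
    heq₂ ▸ s.isSemialgebraic_domain.inter (isSemialgebraic_form_pos (-h))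
  have hsub₁ : D₁ ⊆ s.domain := fun z hz => ((hmem₁ z).1 hz).1
  have hsub₂ : D₂ ⊆ s.domain := fun z hz => ((hmem₂ z).1 hz).1
  set s₁ := s.restrict D₁ hsa₁ hsub₁ with hs₁
  set s₂ := s.restrict D₂ hsa₂ hsub₂ with hs₂
  -- the dissection (rule 1a with the null hyperplane section)
  have hrel : KZ.of s - KZ.of s₁ - KZ.of s₂ ∈ KZ.relations := by
    have h0 := KZ.of_sub_sum_of_mem_relations (Finset.univ : Finset (Fin 2)) s ![s₁, s₂]
      (fun i _ => by
        fin_cases i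
        · simp [hs₁, sdiff_eq_empty.mpr hsub₁]
        · simp [hs₂, sdiff_eq_empty.mpr hsub₂])
      (fun i _ => by fin_cases i <;> exact fun _ _ => rfl)
      (by
        refine measure_mono_null (fun z hz => ?_) (volume_form_eq_zero (k := k) h hh)
        simp only [mem_sdiff, mem_iUnion, Finset.mem_univ, exists_true_left, not_exists,
          Fin.forall_fin_two, Matrix.cons_val_zero, Matrix.cons_val_one] at hz
        obtain ⟨hz, h1, h2⟩ := hz
        have h1' : ¬ 0 < ∑ i, (h.1 i : ℝ) * z (Fin.castAdd k i) + (h.2 : ℝ) := fun hp =>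
          h1 ((hmem₁ z).2 ⟨hz, hp⟩)
        have h2' : ¬ ∑ i, (h.1 i : ℝ) * z (Fin.castAdd k i) + (h.2 : ℝ) < 0 := fun hn =>
          h2 ((hmem₂ z).2 ⟨hz, hn⟩)
        simp only [mem_setOf_eq]
        linarith)
      (fun i _ j _ hij => by
        fin_cases i <;> fin_cases j
        · exact absurd rfl hij
        · refine measure_mono_null (fun z hz => ?_) measure_empty
          have hp := ((hmem₁ z).1 hz.1).2
          have hn := ((hmem₂ z).1 hz.2).2
          linarith
        · refine measure_mono_null (fun z hz => ?_) measure_empty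
          have hn := ((hmem₂ z).1 hz.1).2
          have hp := ((hmem₁ z).1 hz.2).2
          linarith
        · exact absurd rfl hij)
    rw [Fin.sum_univ_two] at h0
    simpa [sub_sub] using h0
  refine ⟨Fin.snoc M h, Fin.snoc M (-h), s₁, s₂, rfl, rfl, hmem₁, hmem₂, rfl, rfl,
    hbd.subset hsub₁, rfl, fun z hz => hint (hsub₁ hz), hbd.subset hsub₂, rfl,
    fun z hz => hint (hsub₂ hz), hrel⟩

end Summit.KontsevichZagierPeriods.ArrangementNormalForm.JanusBands
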